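/-
Copyright (c) 2026 the pub-hodgecm-mathlib formalisation cell (harness21).  Prover seat hodgecm-mathlib-R90-C10-p03 (g0) (valve hand to L1, F4 third hand),
Track B «K2-LIT» ∕ hLiu418 #184♮ = `stmt-HodgeConjecture-24832`, Road I v3, #42F′ — F4 FIX-LIST item (F-ii) (K2E5-r02 (g6) box (C) 2026-09-04T23:16:26Z; LEAD F0P6-plan (g14)
BATCH #131 (2) ∕ #132 (1)): «the adelic Witt frame of `V′` ⇒ `V′` is INDEFINITE at every complex place».
-/
import Summits.HodgeConjecture.HodgeConjecture.Theorems.K2LiuWittLineEmbedding             -- ★ p861452: `exists_lineFrame` (the converse) + the frame vocabulary (`formCongr`, `conjAdele`, `adelicForm`, `finSum`, `JW`, `Fp`)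
import Summits.HodgeConjecture.HodgeConjecture.Theorems.K2E1HeightBigCellLineFormulaU3      -- ★ `extensionEmbedding_fst_conjAdele`, `extensionEmbedding_coe_field` (the place character `ψ_w : 𝔸_L → ℂ`)
import HarnessLib

/-!
# K2_Liu road (hLiu418), F4 (G-gen) fix-list (F-ii): THE ADELIC LINE FRAME `σ(T)ᵀ · diag(dV′)_𝔸 · T = (⟨a′⟩ ⊕ (0 1; 1 0))_𝔸` FORCES `⟨dV′⟩` TO BE INDEFINITE AT
# EVERY COMPLEX PLACE — hence `(p_σ, q_σ) ∈ {(2,1), (1,2)}` at every real place `σ` of `L⁺`, and `V′` has a rational isotropic vector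

Cell `pub/hodgecm-mathlib` (D-0151), Track B.  Lane `--kind proof --supports stmt-HodgeConjecture-24832 --as helper` (count-neutral; THEOREMS ONLY: no `def`,
no `instance`, no notation, no named-fact hypothesis, no `sorry`).

WHY (K2E5-r02 (g6) box (C) on K2Liu-p27's F4 interface memo, item (F-ii) «p ≤ 2 suffices»): FACE-G ∕ FACE-D′ carry the ADELIC Witt frame letter of ★
`K2LiuWittLineEmbedding.exists_lineFrame` BY VALUE — `(a′ : (L⁺)ˣ) (T : GL₃(𝔸_L))` with `formCongr (conjAdele) T (adelicForm L 3 (diagonal dV′)) = adelicForm L (1+2) (JW a′ ⊕ᶠ (0 1; 1 0))`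
— and road (E) ((E-a2) FFT for `p ≤ 2`, B3's place assembly) needs «at every real place `σ` of `L⁺` the signature of `V′ = ⟨dV′⟩` is `(2,1)` or `(1,2)`», i.e. both signs
occur among the real numbers `σ(dV′ₖ)`.  ★ `exists_lineFrame` is the converse direction (isotropic ⇒ frame); this file types the 10-line Sylvester step frame ⇒ indefinite,
WITHOUT signature theory: read the frame identity at a complex place `w` of `L` through the place character `ψ_w = ψ ∘ (·)_w : 𝔸_L →+* ℂ` (★ `extensionEmbedding_fst_conjAdele`:
`ψ_w ∘ (c ⊗ 1) = conj ∘ ψ_w`; ★ `extensionEmbedding_coe_field` + Mathlib `algebraMap_fst_apply`: `ψ_w ∘ (L ↪ 𝔸_L) = φ_w`), obtaining over `ℂ`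
`M̄ᵀ · diag(φ_w dV′) · M = (φ_w a′) ⊕ (0 1; 1 0)` with `det M = ψ_w(det T) ≠ 0`; the column of `M` under the first hyperbolic basis vector is then a NON-ZERO vector `v`
with `Σₖ φ_w(dV′ₖ) |vₖ|² = 0`, impossible if the real numbers `φ_w(dV′ₖ)` (`dV′ₖ ∈ L⁺`) all have one sign.
* §1 `frame_entry_eq` — the `(k,l)` entry of the frame identity read through a ring hom `ψ` with `ψ ∘ conjAdele = conj ∘ ψ` and `ψ ∘ algebraMap = φ`:
  `Σ_m conj(ψ T_{mk}) · φ(dV′_m) · ψ T_{ml} = φ-image of the block Gram entry`; `finSum_inr_inr_zero` — the first hyperbolic vector is isotropic in `JW a′ ⊕ᶠ (0 1; 1 0)`.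
* §2 **`exists_neg_pos_of_lineFrame (w : InfinitePlace L) : ∃ i j, (w.embedding (dV′ i)).re < 0 ∧ 0 < (w.embedding (dV′ j)).re`** and the embedding form
  **`forall_embedding_exists_neg_pos_of_lineFrame : ∀ τ : L →+* ℂ, ∃ i j, (τ (dV′ i)).re < 0 ∧ 0 < (τ (dV′ j)).re`** (Mathlib `mk_embedding` ∕ `mk_eq_iff`: `τ` is `φ_{mk τ}` or its
  conjugate, and `Re` is conjugation-invariant).
* §3 **`exists_isotropic_of_lineFrame`** — `V′` has a rational isotropic vector (★ Landherr `exists_isotropic_of_indefinite_fin`): the converse of ★ `exists_lineFrame`, so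
  «adelic line frame ⇔ isotropic» for diagonal hermitian 3-spaces over a CM field.
HONEST LABEL: HC_CM is proved only modulo the 7 printed citations (2 remaining named inputs: hLiu418 = `stmt-HodgeConjecture-24832`, h413 =
`stmt-HodgeConjecture-24833`) until rung 0 closes; this helper closes nothing and moves no counter.
References: [Scharlau1985HermitianForms] Ch. 7 §9, Ch. 10 §1 (Landherr); [Landherr1936HermitianForms]; [CasselsFrohlichANT1967] Ch. II §10–11, Ch. VII §1.1 (adeles and places);
[GanQiuTakeda2014] §2.6–2.7 (the Witt tower).
-/

set_option autoImplicit false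
set_option linter.dupNamespace false -- the mandated namespace repeats `HodgeConjecture.HodgeConjecture`

noncomputable section

open NumberField NumberField.InfinitePlace IsDedekindDomain
open scoped Matrix ComplexConjugate

namespace Summit.HodgeConjecture.HodgeConjecture.Cruxes.HLiu418.K2LiuLineFrameIndefinite

open Literature.NumberTheory.Automorphic Literature.NumberTheory.Automorphic.UnitaryGroup
open Literature.NumberTheory.Automorphic.Liu2021.Def411WeilCarriers
open Literature.NumberTheory.GelbartRogawski1991 Literature.NumberTheory.GelbartRogawski1991.GRConstruction
open Literature.NumberTheory.QuadraticForms.Landherr (embedding_eq_re re_ne_zero_of_isReal exists_isotropic_of_indefinite_fin)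
open Summit.HodgeConjecture.HodgeConjecture.Cruxes.H413.K2E1HeightBigCellLineFormulaU3 (extensionEmbedding_fst_conjAdele extensionEmbedding_coe_field)

variable (L : Type) [Field L] [NumberField L] [IsCMField L]

/-! ## §1 Reading the frame identity through a place character -/

/-- The first hyperbolic basis vector is ISOTROPIC in the Gram matrix `(a′) ⊕ᶠ (0 1; 1 0)`: its diagonal entry vanishes. [folklore] -/
theorem finSum_inr_inr_zero {S : Type*} [CommRing S] (A : Matrix (Fin 1) (Fin 1) S) (b c : S) :
    finSum 1 2 A !![0, b; c, 0] (finSumFinEquiv (Sum.inr 0)) (finSumFinEquiv (Sum.inr 0)) = 0 := by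
  simp only [finSum, Matrix.reindex_apply, Matrix.submatrix_apply, Equiv.symm_apply_apply, Matrix.fromBlocks_apply₂₂]
  rfl

/-- **The frame identity read through a place character.**  Let `ψ : 𝔸_L →+* ℂ` intertwine the adelic conjugation with complex conjugation (`hψc`) and restrict to
`φ` on `L` (`hψL`).  If `σ(T)ᵀ · diag(dV′)_𝔸 · T = G_𝔸`, then for all `k l`:
`Σ_m conj(ψ T_{mk}) · φ(dV′_m) · ψ T_{ml} = φ(G_{kl})`. [cite: CasselsFrohlichANT1967, Ch. VII §1.1] -/
theorem frame_entry_eq {N : ℕ} (ψ : AdeleRing (𝓞 L) L →+* ℂ) (φ : L →+* ℂ)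
    (hψc : ∀ X, ψ (conjAdele (Fp L) L (IsCMField.complexConj L) X) = conj (ψ X))
    (hψL : ∀ x : L, ψ (algebraMap L (AdeleRing (𝓞 L) L) x) = φ x)
    (dV' : Fin N → L) (G : Matrix (Fin N) (Fin N) L) (T : GL (Fin N) (AdeleRing (𝓞 L) L))
    (hT : formCongr (conjAdele (Fp L) L (IsCMField.complexConj L)) T (adelicForm L N (Matrix.diagonal dV')) = adelicForm L N G) (k l : Fin N) :
    ∑ m, conj (ψ ((T : Matrix (Fin N) (Fin N) (AdeleRing (𝓞 L) L)) m k)) * φ (dV' m) * ψ ((T : Matrix (Fin N) (Fin N) (AdeleRing (𝓞 L) L)) m l) =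
      φ (G k l) := by
  classical
  have h := congrArg (fun M : Matrix (Fin N) (Fin N) (AdeleRing (𝓞 L) L) => ψ (M k l)) hT
  simp only [formCongr, adelicForm] at h
  rw [Matrix.diagonal_map (map_zero _), Matrix.mul_apply] at h
  simp only [Matrix.mul_diagonal, Matrix.transpose_apply, Matrix.map_apply, map_sum, map_mul, hψc, hψL] at h
  exact h

/-! ## §2 Indefiniteness at every complex place -/

/-- **THE ADELIC LINE FRAME FORCES INDEFINITENESS AT EVERY COMPLEX PLACE.**  If `σ(T)ᵀ · diag(dV′)_𝔸 · T = ((a′) ⊕ᶠ (0 1; 1 0))_𝔸` for some `a′ ∈ (L⁺)ˣ` and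
`T ∈ GL₃(𝔸_L)` (the letter of ★ `exists_lineFrame`), and the `dV′ₖ` are non-zero elements of `L⁺`, then at every infinite place `w` of `L` both signs occur among
the real numbers `φ_w(dV′ₖ)` — `V′_w ≅ ⟨a′⟩ ⊕ H` contains a hyperbolic plane, so `diag(φ_w dV′)` has a non-zero isotropic vector (a column of the place-`w` image of `T`),
which a definite real diagonal form has not.  No signature theory is used. [cite: Scharlau1985HermitianForms, Ch. 7 §9] [cite: CasselsFrohlichANT1967, Ch. VII §1.1] -/
theorem exists_neg_pos_of_lineFrame (dV' : Fin 3 → L) (hdV' : ∀ k, IsCMField.complexConj L (dV' k) = dV' k) (hdV'0 : ∀ k, dV' k ≠ 0)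
    (a' : (Fp L)ˣ) (T : GL (Fin 3) (AdeleRing (𝓞 L) L))
    (hT : formCongr (conjAdele (Fp L) L (IsCMField.complexConj L)) T (adelicForm L 3 (Matrix.diagonal dV')) =
      adelicForm L (1 + 2) (finSum 1 2 (JW (Fp L) L a') !![0, 1; 1, 0]))
    (w : InfinitePlace L) : ∃ i j, (w.embedding (dV' i)).re < 0 ∧ 0 < (w.embedding (dV' j)).re := by
  classical
  -- the place character `ψ_w : 𝔸_L →+* ℂ`
  let ψ : AdeleRing (𝓞 L) L →+* ℂ :=
    (Completion.extensionEmbedding w).comp ((Pi.evalRingHom (fun v : InfinitePlace L => v.Completion) w).comp (RingHom.fst _ _))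
  have hψ : ∀ X : AdeleRing (𝓞 L) L, ψ X = Completion.extensionEmbedding w (X.1 w) := fun X => rfl
  have hψc : ∀ X, ψ (conjAdele (Fp L) L (IsCMField.complexConj L) X) = conj (ψ X) := fun X => by
    rw [hψ, hψ, extensionEmbedding_fst_conjAdele]
  have hψL : ∀ x : L, ψ (algebraMap L (AdeleRing (𝓞 L) L) x) = w.embedding x := fun x => by
    rw [hψ, AdeleRing.algebraMap_fst_apply, extensionEmbedding_coe_field]
  -- the place-`w` image `M` of the frame and its column under the first hyperbolic vector
  set M : Matrix (Fin 3) (Fin 3) ℂ := (T : Matrix (Fin (1 + 2)) (Fin (1 + 2)) (AdeleRing (𝓞 L) L)).map ψ with hM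
  have hdet : M.det ≠ 0 := by
    rw [hM, ← RingHom.mapMatrix_apply, ← RingHom.map_det]
    exact (RingHom.isUnit_map _ (Matrix.isUnits_det_units T)).ne_zero
  set i₀ : Fin (1 + 2) := finSumFinEquiv (Sum.inr 0) with hi₀
  let v : Fin 3 → ℂ := fun m => M m i₀
  have hv0 : v ≠ 0 := by
    intro h
    exact hdet (Matrix.det_eq_zero_of_column_eq_zero i₀ fun m => congrFun h m)
  -- `Σ_m φ_w(dV′_m) |v_m|² = 0`
  have hsum : ∑ m, conj (v m) * w.embedding (dV' m) * v m = 0 := by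
    have h := frame_entry_eq L ψ w.embedding hψc hψL dV' _ T hT i₀ i₀
    rw [finSum_inr_inr_zero, map_zero] at h
    exact h
  have hreal : ∀ m, conj (v m) * w.embedding (dV' m) * v m = (((w.embedding (dV' m)).re * Complex.normSq (v m) : ℝ) : ℂ) := by
    intro m
    rw [embedding_eq_re (hdV' m) w.embedding, Complex.ofReal_mul, Complex.ofReal_re, mul_comm (conj (v m)), mul_assoc, mul_comm (conj (v m)),
      Complex.mul_conj]
  simp_rw [hreal] at hsum
  rw [← Complex.ofReal_sum, Complex.ofReal_eq_zero] at hsum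
  -- a definite real diagonal form has no non-zero isotropic vector
  have hne : ∀ m, (w.embedding (dV' m)).re ≠ 0 := fun m => re_ne_zero_of_isReal (hdV' m) (hdV'0 m) w.embedding
  obtain ⟨m₀, hm₀⟩ : ∃ m, v m ≠ 0 := by
    by_contra h
    push Not at h
    exact hv0 (funext h)
  have hsq : 0 < Complex.normSq (v m₀) := Complex.normSq_pos.2 hm₀
  by_contra hcon
  push Not at hcon
  -- `hcon : ∀ i j, (φ dV′ᵢ).re < 0 → (φ dV′ⱼ).re ≤ 0`
  rcases lt_or_gt_of_ne (hne m₀) with hneg | hpos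
  · -- `dV′_{m₀}` negative ⇒ all `≤ 0` ⇒ all `< 0` ⇒ the sum is `< 0`
    have hall : ∀ j, (w.embedding (dV' j)).re < 0 := fun j => lt_of_le_of_ne (hcon m₀ j hneg) (hne j)
    have hlt : ∑ m, (w.embedding (dV' m)).re * Complex.normSq (v m) < 0 := by
      refine (Finset.sum_lt_sum (fun m _ => mul_nonpos_of_nonpos_of_nonneg (hall m).le (Complex.normSq_nonneg _))
        ⟨m₀, Finset.mem_univ _, mul_neg_of_neg_of_pos (hall m₀) hsq⟩).trans_eq ?_
      rw [Finset.sum_const_zero]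
    exact hlt.ne hsum
  · -- `dV′_{m₀}` positive ⇒ all `≥ 0` ⇒ all `> 0` ⇒ the sum is `> 0`
    have hall : ∀ i, 0 < (w.embedding (dV' i)).re := fun i =>
      lt_of_le_of_ne (not_lt.1 fun hi => (not_le.2 hpos) (hcon i m₀ hi)) (hne i).symm
    have hgt : 0 < ∑ m, (w.embedding (dV' m)).re * Complex.normSq (v m) := by
      refine lt_of_eq_of_lt ?_ (Finset.sum_lt_sum (fun m _ => mul_nonneg (hall m).le (Complex.normSq_nonneg _))
        ⟨m₀, Finset.mem_univ _, mul_pos (hall m₀) hsq⟩)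
      rw [Finset.sum_const_zero]
    exact hgt.ne' hsum

/-- **Both signs at every complex embedding** (embedding form): `τ = φ_{mk τ}` or its conjugate (Mathlib `mk_embedding`, `mk_eq_iff`), and real parts are
conjugation-invariant. [cite: Scharlau1985HermitianForms, Ch. 7 §9] -/
theorem forall_embedding_exists_neg_pos_of_lineFrame (dV' : Fin 3 → L) (hdV' : ∀ k, IsCMField.complexConj L (dV' k) = dV' k) (hdV'0 : ∀ k, dV' k ≠ 0)
    (a' : (Fp L)ˣ) (T : GL (Fin 3) (AdeleRing (𝓞 L) L))
    (hT : formCongr (conjAdele (Fp L) L (IsCMField.complexConj L)) T (adelicForm L 3 (Matrix.diagonal dV')) =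
      adelicForm L (1 + 2) (finSum 1 2 (JW (Fp L) L a') !![0, 1; 1, 0]))
    (τ : L →+* ℂ) : ∃ i j, (τ (dV' i)).re < 0 ∧ 0 < (τ (dV' j)).re := by
  obtain ⟨i, j, hi, hj⟩ := exists_neg_pos_of_lineFrame L dV' hdV' hdV'0 a' T hT (InfinitePlace.mk τ)
  have hre : ∀ x : L, ((InfinitePlace.mk τ).embedding x).re = (τ x).re := by
    intro x
    rcases mk_eq_iff.1 (mk_embedding (InfinitePlace.mk τ)) with h | h
    · rw [h]
    · have hx : τ x = conj ((InfinitePlace.mk τ).embedding x) := by rw [← ComplexEmbedding.conjugate_coe_eq, h]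
      rw [hx, Complex.conj_re]
  exact ⟨i, j, by rwa [← hre], by rwa [← hre]⟩

/-! ## §3 The converse of ★ `exists_lineFrame`: a frame forces a rational isotropic vector -/

/-- **ADELIC LINE FRAME ⇒ ISOTROPIC** (Landherr's local–global principle, ★ `exists_isotropic_of_indefinite_fin`, fed by §2): together with ★
`K2LiuWittLineEmbedding.exists_lineFrame` this makes «`V′ = ⟨dV′⟩` is isotropic» and «`V′` admits the adelic line frame `⟨a′⟩ ⊕ H`» EQUIVALENT for diagonal
hermitian 3-spaces over a CM field. [cite: Landherr1936HermitianForms] [cite: Scharlau1985HermitianForms, Ch. 10 §1] -/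
theorem exists_isotropic_of_lineFrame (dV' : Fin 3 → L) (hdV' : ∀ k, IsCMField.complexConj L (dV' k) = dV' k) (hdV'0 : ∀ k, dV' k ≠ 0)
    (a' : (Fp L)ˣ) (T : GL (Fin 3) (AdeleRing (𝓞 L) L))
    (hT : formCongr (conjAdele (Fp L) L (IsCMField.complexConj L)) T (adelicForm L 3 (Matrix.diagonal dV')) =
      adelicForm L (1 + 2) (finSum 1 2 (JW (Fp L) L a') !![0, 1; 1, 0])) :
    ∃ v : Fin 3 → L, v ≠ 0 ∧ ∑ k, dV' k * (v k * IsCMField.complexConj L (v k)) = 0 :=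
  exists_isotropic_of_indefinite_fin L le_rfl dV' hdV' hdV'0 (forall_embedding_exists_neg_pos_of_lineFrame L dV' hdV' hdV'0 a' T hT)

/-- The `iff` packaging: «isotropic ⇔ adelic line frame» for `⟨dV′⟩`, `dV′ : Fin 3 → L⁺ˣ`. [cite: Scharlau1985HermitianForms, Ch. 7 §9, Ch. 10 §1] -/
theorem exists_isotropic_iff_exists_lineFrame (dV' : Fin 3 → L) (hdV' : ∀ k, IsCMField.complexConj L (dV' k) = dV' k) (hdV'0 : ∀ k, dV' k ≠ 0) :
    (∃ v : Fin 3 → L, v ≠ 0 ∧ ∑ k, dV' k * (v k * IsCMField.complexConj L (v k)) = 0) ↔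
      ∃ (a' : (Fp L)ˣ) (T : GL (Fin 3) (AdeleRing (𝓞 L) L)),
        formCongr (conjAdele (Fp L) L (IsCMField.complexConj L)) T (adelicForm L 3 (Matrix.diagonal dV')) =
          adelicForm L (1 + 2) (finSum 1 2 (JW (Fp L) L a') !![0, 1; 1, 0]) :=
  ⟨fun hiso => let ⟨a', T, hT, _⟩ := K2LiuWittLineEmbedding.exists_lineFrame L dV' hdV' hdV'0 hiso; ⟨a', T, hT⟩,
    fun ⟨a', T, hT⟩ => exists_isotropic_of_lineFrame L dV' hdV' hdV'0 a' T hT⟩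

end Summit.HodgeConjecture.HodgeConjecture.Cruxes.HLiu418.K2LiuLineFrameIndefinite

end
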